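import Literature.AlgebraicGeometry.Resolution.WeightedBlowupInvNoIncrease

/-!
# No weighted kangaroo over the origin, in the observatory's own vocabulary

Statement-level corollaries of `WeightedBlowupNoIncrease` (Lemma NI: the second entry never increases)
and `WeightedBlowupInvNoIncrease` (Theorem INV: the transplanted invariant never increases), DERIVED here:

* `WeightedBlowup.mul_ord_le_one_of_max` — for the `TruncLex`-maximal nonnegative admissible coordinate
  cocharacter `γ` of `F` (the transplanted centre FW2) every weight satisfies `γ_i · ord F ≤ 1`: the
  first centre entry is `ord F`. This discharges the hypothesis `hγn` of `not_secondEntryIncreases`, so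
* `WeightedBlowup.not_secondEntryIncreases_of_max` — Lemma NI holds for THE transplanted centre with
  the same hypotheses as Theorem INV, and
* `WeightedBlowup.pair_not_increases` — packaged with the Shade's `IsInvCoord` / `IsReducedWeights`
  (FW2, FW4): at a point of the exceptional divisor over the origin NEITHER entry of the observatory's
  pair (inv^coord, ord of the cleaned residual) increases.

References for the setting only: [AbramovichTemkinWlodarczyk2024] §5.1, Thm. 14;
[AbramovichQuekSchober2025] Def. 4.1, 4.5.
-/

open MvPolynomial Finset

open scoped BigOperators

namespace Literature.AlgebraicGeometry.Resolution

open Literature.AlgebraicGeometry.Resolution.Hauser2010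

noncomputable section

namespace WeightedBlowup

variable {σ : Type*} {K : Type*} [CommRing K] [Fintype σ] [DecidableEq σ]

omit [DecidableEq σ] in
/-- Total degree as a sum over a `Fintype`. [folklore] -/
theorem degree_eq_sum (d : σ →₀ ℕ) : d.degree = ∑ i, d i := by
  simp only [Finsupp.degree, AddMonoidHom.coe_mk, ZeroHom.coe_mk]
  exact Finset.sum_subset (Finset.subset_univ _) fun i _ hi => by simpa using hi

omit [DecidableEq σ] in
/-- The valuation of a constant cocharacter is the constant times the degree. [folklore] -/
theorem monomialValuation_const (c : ℚ) (d : σ →₀ ℕ) :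
    monomialValuation (fun _ : σ => c) d = c * d.degree := by
  unfold monomialValuation
  rw [Finsupp.sum_fintype _ _ (fun i => by simp), degree_eq_sum, Nat.cast_sum, Finset.mul_sum]
  exact Finset.sum_congr rfl fun i _ => by ring

/-- **The first centre entry of the maximal admissible coordinate centre is `ord F`**: every weight of
a `TruncLex`-maximal nonnegative cocharacter satisfies `γ_i · n ≤ 1`, `n = ord F` (else the
constant cocharacter `1/n`, admissible, has a larger first exponent). (derived here) [folklore] -/
theorem mul_ord_le_one_of_max (q : ℕ) (γ : σ → ℚ) (F : MvPolynomial σ K) (n : ℕ)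
    (hn : ordZero F = n) (hγ0 : ∀ i, 0 ≤ γ i)
    (hmax : ∀ γ' : σ → ℚ, (∀ i, 0 ≤ γ' i) → IsAdmissibleFor γ' F →
      ¬ ATW.TruncLex.lt (centreInvariant q γ) (centreInvariant q γ')) :
    ∀ i, γ i * n ≤ 1 := by
  classical
  intro i
  by_contra hlt
  push Not at hlt
  have hnpos : (0 : ℚ) < n := by
    rcases Nat.eq_zero_or_pos n with h | h
    · subst h; simp at hlt; linarith
    · exact_mod_cast h
  obtain ⟨-, hmin⟩ := (ordZero_eq_nat_iff F n).mp hn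
  -- the competitor: the constant cocharacter 1/n
  set γ' : σ → ℚ := fun _ => (n : ℚ)⁻¹ with hγ'
  have hγ'0 : ∀ j, 0 ≤ γ' j := fun j => by simp only [hγ']; positivity
  have hγ'adm : IsAdmissibleFor γ' F := by
    intro d hd
    rw [hγ', monomialValuation_const]
    have hdeg : n ≤ d.degree := by
      by_contra h
      push Not at h
      exact (MvPolynomial.mem_support_iff.mp hd) (hmin d h)
    have : (n : ℚ) ≤ d.degree := by exact_mod_cast hdeg
    rw [inv_mul_eq_div, one_le_div₀ hnpos]
    exact this
  apply hmax γ' hγ'0 hγ'adm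
  -- the index of largest weight decides at the first entry
  obtain ⟨i₀, -, hi₀⟩ := Finset.exists_max_image Finset.univ γ (Finset.univ_nonempty_iff.mpr ⟨i⟩)
  have hγi : (n : ℚ)⁻¹ < γ i := by
    rw [inv_lt_iff_one_lt_mul₀ hnpos]; linarith
  have hγi₀ : (n : ℚ)⁻¹ < γ i₀ := lt_of_lt_of_le hγi (hi₀ i (Finset.mem_univ i))
  have hpos₀ : 0 < γ i₀ := lt_trans (inv_pos.mpr hnpos) hγi₀
  set θ₀ : ℚ := (γ i₀)⁻¹ with hθ₀
  have hθ₀n : θ₀ < n := by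
    have := (inv_lt_inv₀ hpos₀ (inv_pos.mpr hnpos)).mpr hγi₀
    rwa [inv_inv] at this
  rw [centreInvariant_lt_iff]
  apply ATW.TruncLex.lt_of_countP _ _ (exps_sorted _) (exps_sorted _) θ₀
  · intro θ hθ
    rw [countP_exps, countP_exps]
    have h1 : (Finset.univ.filter fun j => γ j ≠ 0 ∧ (γ j)⁻¹ ≤ θ) = ∅ := by
      apply Finset.filter_eq_empty_iff.mpr
      rintro j - ⟨hj0, hjθ⟩
      have hjpos : 0 < γ j := lt_of_le_of_ne (hγ0 j) (Ne.symm hj0)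
      have : θ₀ ≤ (γ j)⁻¹ := by
        rw [hθ₀]; exact inv_anti₀ hjpos (hi₀ j (Finset.mem_univ j))
      linarith
    have h2 : (Finset.univ.filter fun j => γ' j ≠ 0 ∧ (γ' j)⁻¹ ≤ θ) = ∅ := by
      apply Finset.filter_eq_empty_iff.mpr
      rintro j - ⟨-, hjθ⟩
      simp only [hγ', inv_inv] at hjθ
      linarith
    rw [h1, h2]
  · rw [countP_exps, countP_exps]
    have h2 : (Finset.univ.filter fun j => γ' j ≠ 0 ∧ (γ' j)⁻¹ ≤ θ₀) = ∅ := by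
      apply Finset.filter_eq_empty_iff.mpr
      rintro j - ⟨-, hjθ⟩
      simp only [hγ', inv_inv] at hjθ
      linarith
    rw [h2, Finset.card_empty]
    apply Finset.card_pos.mpr
    exact ⟨i₀, by simp [hpos₀.ne', hθ₀]⟩

/-- **Lemma NI for the transplanted centre** (no separate first-entry hypothesis): for `F` cleaned,
`γ ≥ 0` admissible and `TruncLex`-maximal, weights `wᵢ = ℓγᵢ`, `ℓ > 0`, and a point over the origin,
the order of the cleaned residual does not increase. (derived here) [folklore] -/
theorem not_secondEntryIncreases_of_max (q : ℕ) (γ : σ → ℚ) (w : σ → ℕ) (ℓ : ℕ)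
    (b : Option σ → K) (F : MvPolynomial σ K)
    (hF : deletePthPowers q F = F) (hγ0 : ∀ i, 0 ≤ γ i) (hadm : IsAdmissibleFor γ F)
    (hmax : ∀ γ' : σ → ℚ, (∀ i, 0 ≤ γ' i) → IsAdmissibleFor γ' F →
      ¬ ATW.TruncLex.lt (centreInvariant q γ) (centreInvariant q γ'))
    (hw : ∀ i, (w i : ℚ) = ℓ * γ i) (hℓ : 0 < ℓ)
    (hb0 : b none = 0) (hbS : ∀ i, γ i = 0 → b (some i) = 0) :
    ¬ SecondEntryIncreases q w ℓ b F := by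
  classical
  rcases eq_top_or_lt_top (ordZero F) with htop | hlt
  · intro hinc
    unfold SecondEntryIncreases at hinc
    rw [hF, htop] at hinc
    exact not_top_lt hinc
  · obtain ⟨n, hn⟩ := WithTop.ne_top_iff_exists.mp hlt.ne
    exact not_secondEntryIncreases q γ w ℓ b F n hF hn.symm hadm
      (mul_ord_le_one_of_max q γ F n hn.symm hγ0 hmax) hw hℓ hb0 hbS

/-- **No weighted kangaroo over the origin (the observatory's pair, in its own vocabulary).**
Let `x^q + F` (`q > 0`, `F` cleaned of `q`-th powers), `γ ≥ 0` an admissible coordinate cocharacter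
whose invariant IS the transplanted invariant (`IsInvCoord q F (centreInvariant q γ)`, FW2),
`(w₀, w, ℓ)` its reduced weights (`IsReducedWeights`, FW4), and `b` a point of the exceptional divisor
over the origin (`b none = 0`, `bᵢ = 0` off the centre, FW5). Then neither the transplanted invariant
nor the order of the cleaned residual increases at `b`:
`¬ InvCoordIncreases ∧ ¬ SecondEntryIncreases`. (derived here: PATTERNS C13/C18, CLAIMS G3-3 as a
theorem) [folklore] -/
theorem pair_not_increases (q : ℕ) (hq : 0 < q) (γ : σ → ℚ) (w₀ : ℕ) (w : σ → ℕ) (ℓ : ℕ)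
    (b : Option σ → K) (F : MvPolynomial σ K)
    (hF : deletePthPowers q F = F) (hγ0 : ∀ i, 0 ≤ γ i) (hadm : IsAdmissibleFor γ F)
    (hinv : IsInvCoord q F (centreInvariant q γ)) (hred : IsReducedWeights q γ w₀ w ℓ)
    (hb0 : b none = 0) (hbS : ∀ i, γ i = 0 → b (some i) = 0) :
    ¬ InvCoordIncreases q w ℓ b F ∧ ¬ SecondEntryIncreases q w ℓ b F := by
  obtain ⟨hw₀, hℓq, hw, -⟩ := hred
  have hℓ : 0 < ℓ := by rw [hℓq]; exact Nat.mul_pos hq hw₀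
  exact ⟨not_invCoordIncreases q γ w ℓ b F hF hγ0 hadm hinv.2 hw hℓ hb0 hbS,
    not_secondEntryIncreases_of_max q γ w ℓ b F hF hγ0 hadm hinv.2 hw hℓ hb0 hbS⟩

end WeightedBlowup

end

end Literature.AlgebraicGeometry.Resolution
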